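import Literature.AlgebraicGeometry.Motives.HilbertImageInGrassmannianUniversalFamily
import HarnessLib

/-!
# The monomial map `ψ_Y : 𝒪_T^{(Mon_d)} ⟶ (Y → T)_* 𝒪_Y(d)` of a CLOSED SUBSCHEME `Y ⊂ 𝐏(ι; T)`, `ε_w ↦ μ_w|_Y`

Topic `Literature/AlgebraicGeometry/Motives`, namespace `Literature.AlgebraicGeometry.Motives`.  THEOREMS ONLY (no definition, no instance, no notation, no named fact,
no `sorry`); universe `0` (the universe of ★ `Motives/FlatFamilyCutOutByDegreeEquations` and of the Hilbert-scheme assembly).  Cell `hodgecm-mathlib` (D-0151 ∕ FLOOR 0),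
P1 sub-line F-4 layer 2, sub-stub (II-b), brick **(b1) FILE 2A-α (1)** of B-p20 (g14)'s blueprint `BLUEPRINT-F4-IIb-b1-FILE2A` §2: the binder `(ψ, hψ)` of ★ PART B
(`FlatFamilyCutOutByDegreeEquations` §4–§7) EXISTS for every `j : Y ⟶ 𝐏(ι; T)` — extracted VERBATIM from the inline construction of ★
`Motives/HilbertImageInGrassmannianRepresents` (proof of `eq_of_classifies_of_le_ker_vanishingIdeal`, B-p19 lineage): `ψ_Y := φ_T ≫ (π_T)_*(unit of j^* ⊣ j_*) ≫
(j_* of the base-change map j^*𝒪_𝐏(d) → 𝒪_Y(d))` with `φ_T` the monomial map of `𝐏(ι; T)` (★ `exists_monomialMap_projectiveSpace`) and ★ (γ1)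
`SerreTwist.pullbackTwistHom`.  Count-neutral capital; HC_CM is proved only modulo the 7 printed citations until rung 0 closes — nothing here is about HC.

* **`exists_monomialMap_subscheme`** — `∃ ψ : 𝒪_T^{(Mon_d)} ⟶ (j ≫ π_T)_* 𝒪_Y(d), ∀ w V, ψ_V(ε_w|_V) = μ_w|_{Y_V}` (the `hψ` letter of PART B, token for token).

## References
* [Hartshorne1977] R. Hartshorne, *Algebraic Geometry* (1977), II Prop. 5.13 (p. 117) (the graded pieces `Γ(𝒪(d))` and the monomials), II Prop. 5.12 (c).
* [Mumford1966CurvesSurface] D. Mumford, *Lectures on Curves on an Algebraic Surface* (1966), Lecture 15 (II.)–(IV.) (pp. 106–108) (the maps `𝒪_S ⊗ Sym^d → p_*𝒪_Z(d)`).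
-/

noncomputable section

-- `TopCat.Presheaf`/`Scheme.Modules` are not reducible (as in Mathlib's `AlgebraicGeometry/Modules`).
set_option backward.isDefEq.respectTransparency false

open CategoryTheory CategoryTheory.Limits AlgebraicGeometry TopologicalSpace Opposite
open Literature.AlgebraicGeometry.Modules

namespace Literature.AlgebraicGeometry.Motives

/-- **The monomial map of a closed subscheme of `𝐏(ι; T)` exists**: for `j : Y ⟶ 𝐏(ι; T)` and `d : ℕ` there is
`ψ : 𝒪_T^{(Mon_d)} ⟶ (j ≫ π_T)_* 𝒪_Y(d)` with `ψ_V(ε_w|_V) = μ_w|_{Y_V}` for every word `w` and every open `V ⊆ T` — `φ_T` (★ `exists_monomialMap_projectiveSpace`)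
followed by the unit `𝒪_𝐏(d) → j_* j^* 𝒪_𝐏(d)` and `j_*` of ★ `SerreTwist.pullbackTwistHom` (monomials ↦ monomials, ★ `pullbackTwistHom_app_unitSectionLE_monomialSection_le`).
[cite: Mumford1966CurvesSurface, Lecture 15 (II.)–(IV.) (pp. 106–108)] [cite: Hartshorne1977, II Prop. 5.13 (p. 117)] -/
theorem exists_monomialMap_subscheme {ι : Type} {T Y : Scheme.{0}} (j : Y ⟶ Morphisms.projectiveSpace ι T) (d : ℕ) :
    ∃ ψ : freeModule T (Fin d → Fin (Nat.card ι + 1)) ⟶ (Scheme.Modules.pushforward (j ≫ Morphisms.projectiveSpaceFst ι T)).obj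
        (SerreTwist.twistMod (j ≫ pullback.snd (terminal.from T) (terminal.from (Morphisms.projectiveSpaceInt ι))) (unitModule Y) d),
      ∀ (w : Fin d → Fin (Nat.card ι + 1)) (V : T.Opens), ψ.app V (freeSectionOn T w V) =
        ((Scheme.Modules.pushforward (j ≫ Morphisms.projectiveSpaceFst ι T)).obj
          (SerreTwist.twistMod (j ≫ pullback.snd (terminal.from T) (terminal.from (Morphisms.projectiveSpaceInt ι))) (unitModule Y) d)).presheaf.map
          (homOfLE (le_top : V ≤ ⊤)).op
          (show Γ((Scheme.Modules.pushforward (j ≫ Morphisms.projectiveSpaceFst ι T)).obj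
            (SerreTwist.twistMod (j ≫ pullback.snd (terminal.from T) (terminal.from (Morphisms.projectiveSpaceInt ι))) (unitModule Y) d), ⊤) from
            SerreTwist.monomialSection (j ≫ pullback.snd (terminal.from T) (terminal.from (Morphisms.projectiveSpaceInt ι))) d w) := by
  classical
  obtain ⟨φP, hφP, -⟩ := exists_monomialMap_projectiveSpace (ι := ι) T d
  let π := Morphisms.projectiveSpaceFst ι T
  let ιX := pullback.snd (terminal.from T) (terminal.from (Morphisms.projectiveSpaceInt ι))
  let L := SerreTwist.twistMod ιX (unitModule (Morphisms.projectiveSpace ι T)) d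
  let N := (Scheme.Modules.pushforward (j ≫ π)).obj (SerreTwist.twistMod (j ≫ ιX) (unitModule Y) d)
  let E : (Scheme.Modules.pushforward π).obj ((Scheme.Modules.pushforward j).obj ((Scheme.Modules.pullback j).obj L)) ⟶ N :=
    (Scheme.Modules.pushforwardComp j π).hom.app _ ≫ (Scheme.Modules.pushforward (j ≫ π)).map (SerreTwist.pullbackTwistHom j ιX d)
  refine ⟨φP ≫ (Scheme.Modules.pushforward π).map ((Scheme.Modules.pullbackPushforwardAdjunction j).unit.app L) ≫ E, fun w V => ?_⟩
  change ((Scheme.Modules.pushforward (j ≫ π)).map (SerreTwist.pullbackTwistHom j ιX d)).app V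
    ((((Scheme.Modules.pushforwardComp j π).hom.app _).app V)
      ((((Scheme.Modules.pushforward π).map ((Scheme.Modules.pullbackPushforwardAdjunction j).unit.app L)).app V)
        (φP.app V (freeSectionOn T w V)))) = _
  rw [hφP, Scheme.Modules.pushforwardComp_hom_app_app]
  change (SerreTwist.pullbackTwistHom j ιX d).app ((j ≫ π) ⁻¹ᵁ V)
    (((Scheme.Modules.pullbackPushforwardAdjunction j).unit.app L).app (π ⁻¹ᵁ V)
      (L.presheaf.map (homOfLE (le_top : π ⁻¹ᵁ V ≤ ⊤)).op (SerreTwist.monomialSection ιX d w))) = _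
  have hnat : ((Scheme.Modules.pullbackPushforwardAdjunction j).unit.app L).app (π ⁻¹ᵁ V)
      (L.presheaf.map (homOfLE (le_top : π ⁻¹ᵁ V ≤ ⊤)).op (SerreTwist.monomialSection ιX d w)) =
      unitSectionLE j L (V := ⊤) (le_top : (j ≫ π) ⁻¹ᵁ V ≤ j ⁻¹ᵁ ⊤) (SerreTwist.monomialSection ιX d w) := by
    erw [app_presheaf_map]
    rfl
  rw [hnat]
  exact SerreTwist.pullbackTwistHom_app_unitSectionLE_monomialSection_le j ιX d w ((j ≫ π) ⁻¹ᵁ V)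

end Literature.AlgebraicGeometry.Motives

end
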